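import Summits.AtomisticToContinuum.HydrodynamicLimit.Theses.LindebergRandomFuture
import Summits.AtomisticToContinuum.HydrodynamicLimit.Theorems.LambertianContactSwapLambertianEulerOfHearts
import Summits.AtomisticToContinuum.HydrodynamicLimit.Theses.LambertianContactSwap
import Summits.AtomisticToContinuum.HydrodynamicLimit.Theorems.LambertianContactSwapLambertianEulerArchimedes
import Summits.AtomisticToContinuum.HydrodynamicLimit.Theorems.LambertianContactSwapLambertianEulerLambertLaw
import Summits.AtomisticToContinuum.HydrodynamicLimit.Theorems.LambertianContactSwapLambertianEulerPovzner
import Summits.AtomisticToContinuum.HydrodynamicLimit.Theorems.LambertianContactSwapLambertianEulerPairPovzner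
import Summits.AtomisticToContinuum.HydrodynamicLimit.Theorems.LambertianContactSwapLambertianEulerContactIsotropy
import Summits.AtomisticToContinuum.HydrodynamicLimit.Theorems.LambertianContactSwapLambertianEulerMomentLedgerChain
import Summits.AtomisticToContinuum.HydrodynamicLimit.Theorems.LambertianContactSwapLambertianEulerGibbsInvariance
import Summits.AtomisticToContinuum.HydrodynamicLimit.Theorems.LambertianContactSwapLambertianEulerEntropyToHydro
import Summits.AtomisticToContinuum.HydrodynamicLimit.Theorems.LambertianContactSwapLambertianEulerWindow
import Summits.AtomisticToContinuum.HydrodynamicLimit.Theorems.LambertianContactSwapLambertianEulerMarkov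
import Summits.AtomisticToContinuum.HydrodynamicLimit.Theorems.LambertianContactSwapLambertianEulerIterate
import Summits.AtomisticToContinuum.HydrodynamicLimit.Theorems.LambertianContactSwapLambertianEulerDock
import Summits.AtomisticToContinuum.HydrodynamicLimit.Theorems.LambertianContactSwapLambertianEulerKlLedger
import Summits.AtomisticToContinuum.HydrodynamicLimit.Theorems.LambertianContactSwapLambertianEulerLawSemigroup
import Summits.AtomisticToContinuum.HydrodynamicLimit.Theorems.LambertianContactSwapLambertianEulerDockRf
import Summits.AtomisticToContinuum.HydrodynamicLimit.Theorems.LambertianContactSwapLambertianEulerLambertDirMean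
import Summits.AtomisticToContinuum.HydrodynamicLimit.Theorems.LambertianContactSwapLambertianEulerPairMeanSq
import Summits.AtomisticToContinuum.HydrodynamicLimit.Theorems.LambertianContactSwapLambertianEulerPathwiseProduction
import Summits.AtomisticToContinuum.HydrodynamicLimit.Theorems.LambertianContactSwapLambertianEulerWindowLedger
import Summits.AtomisticToContinuum.HydrodynamicLimit.Theorems.LambertianContactSwapLambertianEulerCollisionCompensator
import Summits.AtomisticToContinuum.HydrodynamicLimit.Theorems.LambertianContactSwapLambertianEulerCompensatedJump
import Summits.AtomisticToContinuum.HydrodynamicLimit.Theorems.LambertianContactSwapLambertianEulerAprioriEntropyBound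
import Summits.AtomisticToContinuum.HydrodynamicLimit.Theorems.LambertianContactSwapLambertianEulerCollisionIntensity
import Summits.AtomisticToContinuum.HydrodynamicLimit.Theorems.LambertianContactSwapLambertianEulerTwoTimeLaw
import Summits.AtomisticToContinuum.HydrodynamicLimit.Theorems.LambertianContactSwapLambertianEulerCollisionBudget
import Summits.AtomisticToContinuum.HydrodynamicLimit.Theorems.LambertianContactSwapLambertianEulerExpectedWindowProductionTools
import Summits.AtomisticToContinuum.HydrodynamicLimit.Theorems.LambertianContactSwapLambertianEulerExpectedWindowProduction
import Summits.AtomisticToContinuum.HydrodynamicLimit.Theorems.LambertianContactSwapLambertianEulerProductionSplit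
import Summits.AtomisticToContinuum.HydrodynamicLimit.Theorems.TwoClocksClampedEntropyClockTimeZeroReference
import Summits.AtomisticToContinuum.HydrodynamicLimit.Theorems.TwoClocksClampedEntropyClockDiscreteEntropyGronwall
import Summits.AtomisticToContinuum.HydrodynamicLimit.Theorems.TwoClocksClampedEntropyClockKlDivLawAtLocalGibbsNeTop
import Literature.MathematicalPhysics.KineticTheory.LambertianRedrawNondegenerate
import Literature.MathematicalPhysics.KineticTheory.Hilbert6Wave0Proofs
import Literature.MathematicalPhysics.KineticTheory.HardSphereEulerLLN
import Literature.Barriers.AtomisticToContinuum.HighMomentumCutoff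
import Literature.Analysis.FluidPDE.HardSphereAlexander
import HarnessLib
import Literature.MathematicalPhysics.KineticTheory.HardSphereEulerProofs
import Literature.MeasureTheory.Lebesgue.SaturatedNonmeasurableSet
import Summits.AtomisticToContinuum.HydrodynamicLimit.Theorems.DenseExcursion.Negative.Untied
import Summits.AtomisticToContinuum.HydrodynamicLimit.Theorems.DenseExcursion.Negative.Dichotomy

/-! TTRL-lite variant V4538 of stmt-AtomisticToContinuum-11854

`stub_diluteSelfConsistency` with the hypothesis `Continuous θ₀` DROPPED is FALSE. Without continuity the
temperature profile need not even be measurable: for `θ₀ = 1 + 𝟙_S` with `S ⊆ 𝕋³` a *saturated* non-measurable set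
(every measurable subset of `S` and of `Sᶜ` is null — Halmos's Theorem 16.E, in the tree as
`Literature.MeasureTheory.Lebesgue.exists_saturated_real`, lifted to `𝕋³` along one coordinate by Fubini) the
hard-sphere-restricted tensor power of the local Gibbs profile is not a.e.-measurable, so the Bochner integral
`canonicalPartition` takes its junk value `0`, every `localGibbsLaw` is the ZERO measure, the `t = 0` tie holds for
every field family, and the constant dense state `ρ ≡ σ⁻³` (a classical hard-sphere-Euler solution,
`DenseExcursionUntied.isHardSphereEulerSolution_const`) has packing `1`, refuting the bound `< η = 1`.
So the continuity (indeed: the measurability) of `θ₀` is load-bearing at the level of the formalisation.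
-/

noncomputable section

namespace Summit.AtomisticToContinuum.HydrodynamicLimit.Theorems

open scoped BigOperators Topology ENNReal InnerProductSpace
open MeasureTheory ProbabilityTheory Filter Set InformationTheory
open Literature.MathematicalPhysics.KineticTheory
open Literature.Analysis.FluidPDE Literature.Analysis.FluidPDE.Alexander
open Summit.AtomisticToContinuum.HydrodynamicLimit.Theses.LambertianContactSwap
open Summit.AtomisticToContinuum.HydrodynamicLimit.Theorems.ClampedCurrentsDockPathwise (gSum DgSum)

namespace DiluteSelfConsistencyVar4538

/-! ### A saturated non-measurable set on the circle and on the torus -/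

/-- Halmos's saturated set transported to the unit circle through the fundamental domain `(0, 1]`: every
measurable subset of it and of its complement is null. [cite: Halmos1950, §16 Theorem E (PDF p. 84), with the
measure correspondence `AddCircle.add_projection_respects_measure`] -/
theorem exists_saturated_unitAddCircle :
    ∃ M : Set UnitAddCircle, (∀ B : Set UnitAddCircle, MeasurableSet B → B ⊆ M → volume B = 0) ∧
      (∀ B : Set UnitAddCircle, MeasurableSet B → B ⊆ Mᶜ → volume B = 0) := by
  obtain ⟨M, hM, hMc⟩ := Literature.MeasureTheory.Lebesgue.exists_saturated_real
  refine ⟨{c | ((AddCircle.equivIoc 1 0 c : Ioc (0 : ℝ) (0 + 1)) : ℝ) ∈ M}, ?_, ?_⟩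
  · intro B hB hBM
    rw [AddCircle.add_projection_respects_measure 1 0 hB]
    refine hM _ ((AddCircle.measurable_mk' hB).inter measurableSet_Ioc) ?_
    rintro x ⟨hxB, hxI⟩
    have h := hBM hxB
    simp only [mem_setOf_eq] at h
    rwa [AddCircle.equivIoc_coe_eq hxI] at h
  · intro B hB hBM
    rw [AddCircle.add_projection_respects_measure 1 0 hB]
    refine hMc _ ((AddCircle.measurable_mk' hB).inter measurableSet_Ioc) ?_
    rintro x ⟨hxB, hxI⟩ hxM
    have h := hBM hxB
    simp only [mem_compl_iff, mem_setOf_eq] at h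
    rw [AddCircle.equivIoc_coe_eq hxI] at h
    exact h hxM

/-- Fubini along the first coordinate of `𝕋³ = (ℝ/ℤ)³`: measurable subsets of the slab `{x | x 0 ∈ M}` over a set
of inner measure zero are null. [folklore] -/
theorem volume_eq_zero_of_subset_slab {M : Set UnitAddCircle}
    (hM : ∀ B : Set UnitAddCircle, MeasurableSet B → B ⊆ M → volume B = 0)
    (B : Set T3) (hB : MeasurableSet B) (hBM : B ⊆ {x | x 0 ∈ M}) : volume B = 0 := by
  set Φ := MeasurableEquiv.piFinSuccAbove (fun _ : Fin 3 => UnitAddCircle) 0 with hΦ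
  have hΦmp : MeasurePreserving Φ volume volume :=
    volume_preserving_piFinSuccAbove (fun _ : Fin 3 => UnitAddCircle) 0
  have hΦi : ∀ x : T3, (Φ x).1 = x 0 := fun x => by simp [hΦ]
  set S' : Set (UnitAddCircle × (Fin 2 → UnitAddCircle)) := Φ.symm ⁻¹' B with hS'
  have hSm : MeasurableSet S' := Φ.symm.measurable hB
  have hBS : B = Φ ⁻¹' S' := by
    ext x; simp [hS']
  have h1 : volume B = volume S' := by
    rw [hBS]
    exact hΦmp.measure_preimage_equiv S'
  rw [h1, Measure.volume_eq_prod, Measure.prod_apply_symm hSm]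
  have hsec : ∀ y : Fin 2 → UnitAddCircle, volume ((fun x : UnitAddCircle => (x, y)) ⁻¹' S') = 0 := by
    intro y
    refine hM _ (measurable_prodMk_right hSm) fun x hx => ?_
    have h2 : Φ.symm (x, y) ∈ B := hx
    have h3 := hBM h2
    simp only [mem_setOf_eq] at h3
    have h4 : (Φ.symm (x, y)) 0 = x := by
      have h5 := hΦi (Φ.symm (x, y))
      rw [Φ.apply_symm_apply] at h5
      exact h5.symm
    rwa [h4] at h3
  simp only [hsec, lintegral_zero]

/-- **A saturated non-measurable subset of `𝕋³`**: every measurable subset of `S` and every measurable subset of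
`Sᶜ` is Haar-null. [cite: Halmos1950, §16 Theorem E (PDF p. 84), lifted along a coordinate] -/
theorem exists_saturated_T3 :
    ∃ S : Set T3, (∀ B : Set T3, MeasurableSet B → B ⊆ S → volume B = 0) ∧
      (∀ B : Set T3, MeasurableSet B → B ⊆ Sᶜ → volume B = 0) := by
  obtain ⟨M, hM, hMc⟩ := exists_saturated_unitAddCircle
  exact ⟨{x | x 0 ∈ M}, volume_eq_zero_of_subset_slab hM,
    fun B hB hBM => volume_eq_zero_of_subset_slab (M := Mᶜ) hMc B hB fun x hx => hBM hx⟩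

/-- A saturated set is not null-measurable for the restriction of the measure to any set of positive measure.
[folklore] -/
theorem not_nullMeasurableSet_of_saturated {α : Type*} [MeasurableSpace α] {μ : Measure α} {S Q : Set α}
    (hS : ∀ B : Set α, MeasurableSet B → B ⊆ S → μ B = 0)
    (hSc : ∀ B : Set α, MeasurableSet B → B ⊆ Sᶜ → μ B = 0) (hQ : μ Q ≠ 0) :
    ¬ NullMeasurableSet S (μ.restrict Q) := by
  intro h
  have h0 : ∀ {S' : Set α}, (∀ B : Set α, MeasurableSet B → B ⊆ S' → μ B = 0) →
      NullMeasurableSet S' (μ.restrict Q) → μ.restrict Q S' = 0 := by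
    intro S' hS' h'
    obtain ⟨E, hES, hEm, hEae⟩ := h'.exists_measurable_subset_ae_eq
    rw [← measure_congr hEae]
    exact nonpos_iff_eq_zero.1 ((Measure.restrict_apply_le Q E).trans (hS' E hEm hES).le)
  have h1 : μ.restrict Q S = 0 := h0 hS h
  have h2 : μ.restrict Q Sᶜ = 0 := h0 hSc h.compl
  have h3 : μ.restrict Q univ = 0 := by
    have := measure_union_le (μ := μ.restrict Q) S Sᶜ
    rw [union_compl_self, h1, h2, add_zero] at this
    exact nonpos_iff_eq_zero.1 this
  rw [Measure.restrict_apply_univ] at h3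
  exact hQ h3

/-! ### The two temperatures are distinguished by the Maxwellian at small velocities -/

/-- At velocity `0` the unit-density Maxwellian is strictly decreasing in the temperature: `M_{1,0,2}(0) < M_{1,0,1}(0)`.
[folklore] -/
theorem localMaxwellian_two_lt_one_at_zero :
    localMaxwellian 1 2 (0 : V3) 0 < localMaxwellian 1 1 (0 : V3) 0 := by
  have hfin : (Module.finrank ℝ V3 : ℝ) = 3 := by simp
  simp only [localMaxwellian, hfin, sub_self, norm_zero, one_mul, mul_one]
  have hz : (-(3 : ℝ)) / 2 < 0 := by norm_num
  have h0 : ∀ t : ℝ, Real.exp (-(0 : ℝ) ^ 2 / t) = 1 := fun t => by simp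
  simp only [h0, mul_one]
  exact Real.rpow_lt_rpow_of_neg (by positivity) (by nlinarith [Real.pi_pos]) hz

/-! ### The Gibbs weight of the two-temperature profile is not integrable -/

/-- **Non-measurable temperature kills the partition function.** For `θ₀ = 2` on a saturated set `S` and `= 1` off
it (activity `1`, velocity `0`), the hard-sphere-restricted tensor power of the local Gibbs profile of `N + 1`
spheres of diameter `hsDiameter σ N`, `σ ≤ 1/2`, is NOT integrable (it is not a.e.-measurable: by Fubini one of its
sections would make `S` null-measurable on an open set of positive measure). [folklore] -/
theorem not_integrable_gibbsWeight {S : Set T3}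
    (hS : ∀ B : Set T3, MeasurableSet B → B ⊆ S → volume B = 0)
    (hSc : ∀ B : Set T3, MeasurableSet B → B ⊆ Sᶜ → volume B = 0)
    {θ₀ : T3 → ℝ} (hθ2 : ∀ x ∈ S, θ₀ x = 2) (hθ1 : ∀ x, x ∉ S → θ₀ x = 1)
    {σ : ℝ} (hσ2 : σ ≤ 1 / 2) (N : ℕ) :
    ¬ Integrable ((hardSphereDomain (Torus.geometry (Fin 3)) (N + 1) (hsDiameter σ N)).indicator
        (tensorPow (N + 1) (localGibbsProfile (fun _ => (1 : ℝ)) (fun _ => (0 : V3)) θ₀))) volume := by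
  classical
  intro hI
  have hθpos : ∀ x, 0 < θ₀ x := fun x => by
    by_cases hx : x ∈ S
    · rw [hθ2 x hx]; norm_num
    · rw [hθ1 x hx]; norm_num
  -- the weight in position/velocity coordinates
  have hG : AEStronglyMeasurable (fun p : (Fin (N + 1) → T3) × (Fin (N + 1) → V3) =>
      posWeight (fun _ : T3 => (1 : ℝ)) (hsDiameter σ N) (N + 1) p.1 *
        ∏ i, localMaxwellian 1 (θ₀ (p.1 i)) (0 : V3) (p.2 i))
      ((volume : Measure (Fin (N + 1) → T3)).prod volume) := by
    have h := hI.aestronglyMeasurable.comp_measurePreserving measurePreserving_zipConfig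
    refine h.congr (Filter.Eventually.of_forall fun p => ?_)
    rcases p with ⟨x, v⟩
    exact indicator_tensorPow_zipConfig (a₀ := fun _ => (1 : ℝ)) (u₀ := fun _ => (0 : V3)) (θ₀ := θ₀)
      (hsDiameter σ N) x v
  -- a velocity section at which the two temperatures are distinguished
  set U : Set (Fin (N + 1) → V3) :=
    {v | localMaxwellian 1 2 (0 : V3) (v 0) < localMaxwellian 1 1 (0 : V3) (v 0)} with hU
  have hUo : IsOpen U :=
    isOpen_lt ((continuous_localMaxwellian 1 2 (0 : V3)).comp (continuous_apply 0))
      ((continuous_localMaxwellian 1 1 (0 : V3)).comp (continuous_apply 0))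
  have hUne : U.Nonempty := ⟨0, by simpa [hU] using localMaxwellian_two_lt_one_at_zero⟩
  have hUpos : volume U ≠ 0 := (hUo.measure_pos volume hUne).ne'
  obtain ⟨v, hvU, hv⟩ : ∃ v ∈ U, AEStronglyMeasurable (fun x : Fin (N + 1) → T3 =>
      posWeight (fun _ : T3 => (1 : ℝ)) (hsDiameter σ N) (N + 1) x *
        ∏ i, localMaxwellian 1 (θ₀ (x i)) (0 : V3) (v i)) volume := by
    have hre : ∀ᵐ w ∂(volume.restrict U), w ∈ U ∧ AEStronglyMeasurable (fun x : Fin (N + 1) → T3 =>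
        posWeight (fun _ : T3 => (1 : ℝ)) (hsDiameter σ N) (N + 1) x *
          ∏ i, localMaxwellian 1 (θ₀ (x i)) (0 : V3) (w i)) volume :=
      (ae_restrict_mem hUo.measurableSet).and (ae_restrict_of_ae hG.prodMk_right)
    haveI : (ae (volume.restrict U)).NeBot := ae_neBot.2 (by rwa [Ne, Measure.restrict_eq_zero])
    obtain ⟨w, hw1, hw2⟩ := hre.exists
    exact ⟨w, hw1, hw2⟩
  have hg12 : localMaxwellian 1 1 (0 : V3) (v 0) ≠ localMaxwellian 1 2 (0 : V3) (v 0) := (ne_of_lt hvU).symm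
  -- split off particle `0`
  set e := MeasurableEquiv.piFinSuccAbove (fun _ : Fin (N + 1) => T3) 0 with he
  have hemp : MeasurePreserving e volume volume := volume_preserving_piFinSuccAbove (fun _ : Fin (N + 1) => T3) 0
  have he1 : ∀ z : Fin (N + 1) → T3, (e z).1 = z 0 := fun z => by simp [he]
  have he2 : ∀ (z : Fin (N + 1) → T3) (j : Fin N), (e z).2 j = z j.succ := fun z j => by
    simp [he, Fin.tail]
  have hsymm0 : ∀ (a : T3) (y : Fin N → T3), (e.symm (a, y)) 0 = a := fun a y => by
    have h := he1 (e.symm (a, y)); rw [e.apply_symm_apply] at h; exact h.symm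
  have hsymmS : ∀ (a : T3) (y : Fin N → T3) (j : Fin N), (e.symm (a, y)) j.succ = y j := fun a y j => by
    have h := he2 (e.symm (a, y)) j; rw [e.apply_symm_apply] at h; exact h.symm
  have hH : AEStronglyMeasurable ((fun x : Fin (N + 1) → T3 =>
      posWeight (fun _ : T3 => (1 : ℝ)) (hsDiameter σ N) (N + 1) x *
        ∏ i, localMaxwellian 1 (θ₀ (x i)) (0 : V3) (v i)) ∘ e.symm)
      ((volume : Measure T3).prod (volume : Measure (Fin N → T3))) := by
    have h := hv.comp_measurePreserving hemp.symm
    rwa [Measure.volume_eq_prod] at h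
  -- the open set of strictly non-overlapping positions and its sections
  set P : Set (Fin (N + 1) → T3) :=
    {x | ∀ i j, i ≠ j → hsDiameter σ N < Torus.euclidDist (x i) (x j)} with hP
  have hPo : IsOpen P := isOpen_setOf_lt_euclidDist (hsDiameter σ N) (N + 1)
  have hPpos : 0 < volume P := volume_setOf_lt_euclidDist_pos hσ2 N
  set T : Set (T3 × (Fin N → T3)) := e.symm ⁻¹' P with hT
  have hTm : MeasurableSet T := hPo.measurableSet.preimage e.symm.measurable
  have hTpos : volume T ≠ 0 := by
    rw [hT, hemp.symm.measure_preimage_equiv P]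
    exact hPpos.ne'
  have hfreq : ∃ᶠ y in ae (volume : Measure (Fin N → T3)),
      volume ((fun a : T3 => (a, y)) ⁻¹' T) ≠ 0 := by
    by_contra hcon
    rw [Filter.not_frequently] at hcon
    apply hTpos
    rw [Measure.volume_eq_prod, Measure.prod_apply_symm hTm]
    have hae : (fun y : Fin N → T3 => volume ((fun a : T3 => (a, y)) ⁻¹' T)) =ᵐ[volume] fun _ => 0 := by
      filter_upwards [hcon] with y hy
      simpa using hy
    rw [lintegral_congr_ae hae, lintegral_zero]
  obtain ⟨y, hy1, hy2⟩ := (hfreq.and_eventually hH.prodMk_right).exists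
  -- the section at `y`
  set Q : Set T3 := (fun a : T3 => (a, y)) ⁻¹' T with hQ
  have hQm : MeasurableSet Q := measurable_prodMk_right hTm
  set R : ℝ := ∏ j : Fin N, localMaxwellian 1 (θ₀ (y j)) (0 : V3) (v j.succ) with hR
  have hRpos : 0 < R := Finset.prod_pos fun j _ => localMaxwellian_pos one_pos (hθpos _) _ _
  have hKQ : ∀ a ∈ Q, ((fun x : Fin (N + 1) → T3 =>
      posWeight (fun _ : T3 => (1 : ℝ)) (hsDiameter σ N) (N + 1) x *
        ∏ i, localMaxwellian 1 (θ₀ (x i)) (0 : V3) (v i)) ∘ e.symm) (a, y) =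
      localMaxwellian 1 (θ₀ a) (0 : V3) (v 0) * R := by
    intro a ha
    have haP : e.symm (a, y) ∈ P := ha
    have haD : e.symm (a, y) ∈ posDomain (hsDiameter σ N) (N + 1) := fun i j hij => (haP i j hij).le
    simp only [Function.comp_apply]
    rw [posWeight, Set.indicator_of_mem haD]
    simp only [Finset.prod_const_one, one_mul]
    rw [Fin.prod_univ_succ, hsymm0]
    simp only [hsymmS]
    rw [hR]
  have hK : AEStronglyMeasurable (fun a : T3 => localMaxwellian 1 (θ₀ a) (0 : V3) (v 0))
      ((volume : Measure T3).restrict Q) := by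
    have h1 : AEStronglyMeasurable (fun a : T3 => ((fun x : Fin (N + 1) → T3 =>
        posWeight (fun _ : T3 => (1 : ℝ)) (hsDiameter σ N) (N + 1) x *
          ∏ i, localMaxwellian 1 (θ₀ (x i)) (0 : V3) (v i)) ∘ e.symm) (a, y))
        ((volume : Measure T3).restrict Q) := hy2.restrict
    have h2 : (fun a : T3 => localMaxwellian 1 (θ₀ a) (0 : V3) (v 0)) =ᵐ[(volume : Measure T3).restrict Q]
        fun a => R⁻¹ * ((fun x : Fin (N + 1) → T3 =>
          posWeight (fun _ : T3 => (1 : ℝ)) (hsDiameter σ N) (N + 1) x *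
            ∏ i, localMaxwellian 1 (θ₀ (x i)) (0 : V3) (v i)) ∘ e.symm) (a, y) := by
      filter_upwards [ae_restrict_mem hQm] with a ha
      rw [hKQ a ha]
      field_simp
    exact (h1.const_mul R⁻¹).congr h2.symm
  have hnull : NullMeasurableSet
      ((fun a : T3 => localMaxwellian 1 (θ₀ a) (0 : V3) (v 0)) ⁻¹' {localMaxwellian 1 2 (0 : V3) (v 0)})
      ((volume : Measure T3).restrict Q) :=
    hK.aemeasurable.nullMeasurableSet_preimage (measurableSet_singleton _)
  have hpre : (fun a : T3 => localMaxwellian 1 (θ₀ a) (0 : V3) (v 0)) ⁻¹'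
      {localMaxwellian 1 2 (0 : V3) (v 0)} = S := by
    ext a
    simp only [mem_preimage, mem_singleton_iff]
    constructor
    · intro h
      by_contra haS
      rw [hθ1 a haS] at h
      exact hg12 h
    · intro haS
      rw [hθ2 a haS]
  rw [hpre] at hnull
  exact not_nullMeasurableSet_of_saturated hS hSc hy1 hnull

/-! ### Vanishing partition function: zero laws, vacuous tie -/

/-- If the canonical partition function vanishes, the local Gibbs law is the ZERO measure. [folklore] -/
theorem localGibbsLaw_eq_zero_of_partition {σ : ℝ} {a₀ θ₀ : T3 → ℝ} {u₀ : T3 → V3} (N : ℕ)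
    (hZ : canonicalPartition (Torus.geometry (Fin 3)) (hsDiameter σ N) (N + 1) (localGibbsProfile a₀ u₀ θ₀) = 0)
    (Φ : HardSphereFlow (Torus.geometry (Fin 3)) (hsDiameter σ N) (N + 1)) :
    localGibbsLaw σ a₀ u₀ θ₀ N Φ = 0 := by
  rw [localGibbsLaw, particleLaw_eq]
  have hdens : (fun z : Config (N + 1) (Fin 3) T3 => ENNReal.ofReal
      (canonicalDensity (Torus.geometry (Fin 3)) (hsDiameter σ N) (N + 1) (localGibbsProfile a₀ u₀ θ₀) z)) = 0 := by
    funext z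
    simp [canonicalDensity, hZ]
  rw [hdens]
  exact withDensity_zero

end DiluteSelfConsistencyVar4538

open DiluteSelfConsistencyVar4538

/-- **TTRL variant V4538 of `stub_diluteSelfConsistency` (hypothesis `Continuous θ₀` dropped) is FALSE.**
Witness: `η = 1`, `a₀ ≡ 1`, `u₀ ≡ 0`, `θ₀ = 1 + 𝟙_S` for a saturated non-measurable `S ⊆ 𝕋³`; then every
canonical partition function is the junk value `0` (`not_integrable_gibbsWeight`), every local Gibbs law is `0`,
the `t = 0` tie holds for the constant state of density `σ⁻³` (`σ = min (σ₀/2) (1/4)`), a classical solution with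
packing `1 ≥ η`. Repaired statement `C′`: restore `Continuous θ₀` (or at least `Measurable θ₀`), i.e. the parent stub;
the witness misses `C′` since `𝟙_S` is not measurable. [folklore] -/
theorem stub_diluteSelfConsistency_var4538_false :
    ¬ (∀ η : ℝ, 0 < η → ∀ (a₀ θ₀ : T3 → ℝ) (u₀ : T3 → V3), Continuous a₀ → Continuous u₀ →
      (∀ x, 0 < a₀ x) → (∀ x, 0 < θ₀ x) → ∃ σ₀ : ℝ, 0 < σ₀ ∧ ∀ σ : ℝ, 0 < σ → σ < σ₀ →
      ∀ (T : ℝ) (ρ θ : ℝ → T3 → ℝ) (u : ℝ → T3 → V3), IsHardSphereEulerSolution σ T ρ u θ →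
      ∀ Φ : (N : ℕ) → HardSphereFlow (Torus.geometry (Fin 3)) (hsDiameter σ N) (N + 1),
      TendstoHydroFieldsAt (fun N => localGibbsLaw σ a₀ u₀ θ₀ N (Φ N)) Φ ρ u θ 0 →
      ∀ t ∈ Set.Ico 0 T, ∀ x, ρ t x * σ ^ 3 < η) := by
  intro h
  obtain ⟨S, hS, hSc⟩ := exists_saturated_T3
  have hθ2 : ∀ x ∈ S, (fun x : T3 => S.indicator (fun _ => (1 : ℝ)) x + 1) x = 2 := fun x hx => by
    simp only [Set.indicator_of_mem hx]; norm_num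
  have hθ1 : ∀ x, x ∉ S → (fun x : T3 => S.indicator (fun _ => (1 : ℝ)) x + 1) x = 1 := fun x hx => by
    simp only [Set.indicator_of_notMem hx]; norm_num
  have hθpos : ∀ x, 0 < (fun x : T3 => S.indicator (fun _ => (1 : ℝ)) x + 1) x := fun x => by
    by_cases hx : x ∈ S
    · rw [hθ2 x hx]; norm_num
    · rw [hθ1 x hx]; norm_num
  obtain ⟨σ₀, hσ₀, D⟩ := h 1 one_pos (fun _ => 1) (fun x : T3 => S.indicator (fun _ => (1 : ℝ)) x + 1)
    (fun _ => 0) continuous_const continuous_const (fun _ => one_pos) hθpos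
  have hσ : 0 < min (σ₀ / 2) (1 / 4) := lt_min (by positivity) (by norm_num)
  have hσlt : min (σ₀ / 2) (1 / 4) < σ₀ := (min_le_left _ _).trans_lt (by linarith)
  have hσ2 : min (σ₀ / 2) (1 / 4) ≤ 1 / 2 := (min_le_right _ _).trans (by norm_num)
  have hσ2' : min (σ₀ / 2) (1 / 4) < 1 / 2 := (min_le_right _ _).trans_lt (by norm_num)
  obtain ⟨Φ⟩ := DenseExcursionDichotomy.flows_nonempty hσ hσ2'
  have hZ : ∀ N, canonicalPartition (Torus.geometry (Fin 3)) (hsDiameter (min (σ₀ / 2) (1 / 4)) N) (N + 1)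
      (localGibbsProfile (fun _ => (1 : ℝ)) (fun _ => (0 : V3))
        (fun x : T3 => S.indicator (fun _ => (1 : ℝ)) x + 1)) = 0 := fun N => by
    unfold canonicalPartition
    exact integral_undef (not_integrable_gibbsWeight hS hSc hθ2 hθ1 hσ2 N)
  have hlaw : ∀ N, localGibbsLaw (min (σ₀ / 2) (1 / 4)) (fun _ => (1 : ℝ)) (fun _ => (0 : V3))
      (fun x : T3 => S.indicator (fun _ => (1 : ℝ)) x + 1) N (Φ N) = 0 :=
    fun N => localGibbsLaw_eq_zero_of_partition N (hZ N) (Φ N)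
  have hr : 0 < ((min (σ₀ / 2) (1 / 4)) ^ 3)⁻¹ := inv_pos.2 (pow_pos hσ 3)
  have hE := DenseExcursionUntied.isHardSphereEulerSolution_const (min (σ₀ / 2) (1 / 4)) 1 (0 : V3) hr one_pos
  have htie : TendstoHydroFieldsAt (fun N => localGibbsLaw (min (σ₀ / 2) (1 / 4)) (fun _ => (1 : ℝ))
      (fun _ => (0 : V3)) (fun x : T3 => S.indicator (fun _ => (1 : ℝ)) x + 1) N (Φ N)) Φ
      (fun _ _ => ((min (σ₀ / 2) (1 / 4)) ^ 3)⁻¹) (fun _ _ => (0 : V3)) (fun _ _ => (1 : ℝ)) 0 := by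
    intro χ _ δ _
    have h0 : ∀ (N : ℕ) (A : Set (Config (N + 1) (Fin 3) T3)),
        localGibbsLaw (min (σ₀ / 2) (1 / 4)) (fun _ => (1 : ℝ)) (fun _ => (0 : V3))
          (fun x : T3 => S.indicator (fun _ => (1 : ℝ)) x + 1) N (Φ N) A = 0 := fun N A => by
      rw [hlaw N]; rfl
    simp only [h0]
    exact ⟨tendsto_const_nhds, tendsto_const_nhds, tendsto_const_nhds⟩
  have hlt := D _ hσ hσlt 1 _ _ _ hE Φ htie 0 ⟨le_rfl, one_pos⟩ 0
  have hone : ((min (σ₀ / 2) (1 / 4)) ^ 3)⁻¹ * (min (σ₀ / 2) (1 / 4)) ^ 3 = 1 :=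
    inv_mul_cancel₀ (pow_pos hσ 3).ne'
  linarith

end Summit.AtomisticToContinuum.HydrodynamicLimit.Theorems

end
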